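import Mathlib
import Literature.Probability.LatticeModels.IsingThermodynamics
import Literature.Probability.LatticeModels.IsingExponents
import Literature.Probability.LatticeModels.ScalingLimit
import Literature.Probability.LatticeModels.CFTData
import Literature.Probability.LatticeModels.ConformalBootstrap
import HarnessLib.Audit
import Literature.MathematicalPhysics.QuantumFieldTheory.CFTAxioms
import HarnessLib

/-!
# CritIsing3DIsCFT — CONJECTURE (obligation of CriticalPhenomena/Ising3DConformalLimit)

Unproven conjecture migrated by the gate from `Literature/MathematicalPhysics/QuantumFieldTheory/CFTAxioms.lean` (`Literature.MathematicalPhysics.QuantumFieldTheory.CritIsing3DIsCFT`): unproven conjectures are obligations of our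
theories, not literature facts (human ruling 2026-08-15). Provenance: DuminilCopinICM2022. Routes use it as a crux item or via
`--conditional-bridge --conditional-on CritIsing3DIsCFT`; a proof goes in the sibling `Theorems/CritIsing3DIsCFTHolds.lean` as `theorem CritIsing3DIsCFT_holds : CritIsing3DIsCFT` so this file stays a conjecture LEAF that Literature/ may import.
-/

namespace Summit.CriticalPhenomena.Ising3DConformalLimit

open Literature Literature.MathematicalPhysics Literature.MathematicalPhysics.QuantumFieldTheory
open Filter Topology
open Literature.Probability.LatticeModels

/-- OPEN CONJECTURE — **crit-ising.S24**, the CFT-axioms reading of the critical 3D Ising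
scaling limit. Posed as an open problem in Duminil-Copin, Proc. ICM 2022, §8.4 (arXiv:2208.00864
p. 28: "the analogous question remains widely open in 3D"; p. 29: "proving that the critical 3D
Ising model indeed converges to a CFT" is "widely open") and §9, p. 30 ("critical properties of
the 3D model … among the most important unsolved puzzles"); the CFT reading itself follows
Poland–Rychkov–Vichi, Rev. Mod. Phys. 91 (2019) 015002, §§II–III, and Kravchuk–Qiao–Rychkov,
Commun. Math. Phys. 386 (2021) (OS axioms + OPE). Not a result in print: never to be asserted,
never a discharge target (`CritIsing3DIsCFT_holds` cannot be expected from the literature); it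
is the route crux `stmt-CriticalPhenomena-0665`. Name kept (no `…Conjecture` suffix) because of
its users in `Literature.Barriers.CriticalPhenomena.BootstrapLatticeBlindness`,
`CFTAxiomsProofs` and `Summits/CriticalPhenomena/Ising3DConformalLimit`.
Statement: there exist a renormalisation `ρ : (0,1] → (0,∞)`, a standard family of 3D conformal
blocks `B` and unitary, reflection-positive, `ℤ₂`-symmetric 3D CFT data `D` with exactly one
relevant `ℤ₂`-odd scalar `σ` and one relevant non-identity `ℤ₂`-even scalar `ε` and convergent
crossing-symmetric OPEs (`IsIsingLikeCFT B D`), such that for every `n` the rescaled critical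
Ising correlators `ρ(δ)^n ⟨σ_{[x₁/δ]} ⋯ σ_{[xₙ/δ]}⟩⁺_{β_c}` on `ℤ³` converge as `δ → 0⁺`,
locally uniformly on non-coincident configurations of `ℝ³`, to the `n`-point functions
`⟨σ(x₁) ⋯ σ(xₙ)⟩` of the spin field `σ` of `D`. In particular the limit is Möbius covariant
with `Δ = Δ_σ` (`CritIsing3DIsCFT.exists_isMoebiusCovariant`).
Faithfulness notes: the printed text asks only that `σ` be *the lowest* `ℤ₂`-odd scalar primary
of a unitary `ℤ₂`-symmetric CFT; `IsIsingLikeCFT` demands a *unique relevant* `ℤ₂`-odd scalar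
(and a unique relevant non-identity `ℤ₂`-even scalar), which is a mild strengthening (unique
relevant odd scalar ⇒ lowest) — the standard characterisation of "the 3D Ising CFT" needed by
**crit-ising.S23**. The printed "limits `Sₙ` of S01" is rendered by the scaling-limit clause
itself; non-Gaussianity (`HasNontrivialU4`) is not part of this statement.
[cite: DuminilCopinICM2022, §8.4 (arXiv pp. 28–29) and §9 (p. 30): posed as open]
[status: open] -/
@[conjecture] def CritIsing3DIsCFT : Prop :=
  ∃ (ρ : ℝ → ℝ) (B : ConformalBlocks 3) (D : CFTData 3) (h : IsIsingLikeCFT B D),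
    (∀ δ ∈ Set.Ioc (0 : ℝ) 1, 0 < ρ δ) ∧ B.IsStandard ∧
      HasPointwiseScalingLimit (criticalCorr 3) ρ (D.corr h.sigmaField)

end Summit.CriticalPhenomena.Ising3DConformalLimit
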